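import Summits.NavierStokesRegularity.FunctionalMining.BiaxialSaintVenant
import HarnessLib

/-!
# FunctionalMining — calculus of a smooth unit axis field on the torus: the Saint-Venant contraction
# of `n⊗n` against `n` is FIRST ORDER, `J(n⊗n; n) = 2(|∇n|² − |(n·∇)n|²) − tr((∇n)²) − (div n)²`
# (THEOREM R of `SIEVELD.md` §3.4b (4e), step (i), second half; every dimension)

Search for candidate a priori estimates; no regularity claim. Cell `pub-nsfunc`, prove seat (gen 20).
Static calculus of smooth fields on the flat torus; nothing about Navier–Stokes dynamics.

Let `n : T^d → ℝ^d` be smooth with `|n| ≡ 1`; write `b_{lk} = ∂ₖn_l`, `θ = div n = ∑ₖ b_{kk}`,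
`a_l = ((n·∇)n)_l = ∑ₖ b_{lk} n_k`, `|∇n|² = ∑ b_{lk}²`, `tr((∇n)²) = ∑ b_{lk}b_{kl}`, `h_{kml} = ∂ₖ∂ₘ n_l`.
* `unit_first`, `unit_second`: `∑ᵢ nᵢ∂ₖnᵢ = 0` and `∑ᵢ nᵢ∂ₖ∂ₘnᵢ = −∑ᵢ ∂ₖnᵢ∂ₘnᵢ` (differentiate `|n|² = 1`).
* `dd_axis_product`: `∂ₖ∂ₘ(n_l n_p)` by the product rule; `dd_axis_trace`: `∑_l ∂ₐ∂_b(n_l²) = 0`.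
* `axis_T1`, `axis_T2`, `axis_T3`: the three contractions `∑ nᵢnⱼ∂ᵢ∂ₖ(nⱼnₖ) = −|a|² + Y`,
  `∑ nᵢnⱼ∂ₖ∂ₖ(nᵢnⱼ) = −2|∇n|²`, `∑ ∂ₖ∂ₗ(nₖnₗ) = 2Y + θ² + tr((∇n)²)`, `Y := ∑ᵢₖ nᵢ ∂ᵢ∂ₖnₖ`.
* **`svForm_axis`**: `J(n⊗n; n(x))(x) = 2(|∇n|² − |a|²) − tr((∇n)²) − θ²` — the second derivatives (`Y`)
  cancel (SIEVELD §3.4b (4e)(i): in `d = 3` the right side is `2[(n·curl n)² − σ₂(∇n)]`,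
  `σ₂ = ½(θ² − tr((∇n)²))`; two-party at paper level, census-2 INC-IDENTITY-B; here kernel-checked in
  every dimension, `ε`-free).
Consumed by `BiaxialTwistFree.lean`. [ours = assembly; folklore = the calculus]
-/

noncomputable section

open MeasureTheory Set Filter Topology

namespace Summit.NavierStokesRegularity.FunctionalMining
open Literature.Analysis Literature.Analysis.FunctionSpaces Literature.Analysis.FunctionSpaces.Torus
  Literature.Analysis.FluidPDE

namespace BiaxialEikonal

variable {d : Type*} [Fintype d] [DecidableEq d]

section Axis

variable {n : UnitAddTorus d → EuclideanSpace ℝ d} (hn : Torus.IsSmooth n)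
include hn

/-! ## 1. Product rule and the unit constraints -/

omit [DecidableEq d] in
/-- `C¹` bookkeeping for components. [folklore] -/
theorem c1_comp (l : d) : Torus.IsContDiff 1 (fun y => n y l) := (hn.apply l).isContDiff (by simp)

/-- `C¹` bookkeeping for first derivatives of components. [folklore] -/
theorem c1_dcomp (m l : d) : Torus.IsContDiff 1 (fun y => Torus.partialDeriv m n y l) :=
  ((hn.partialDeriv m).apply l).isContDiff (by simp)

/-- `∂ₘ(n_l n_p) = n_l ∂ₘn_p + ∂ₘn_l n_p` at function level. [folklore] -/
theorem partialDeriv_axis_product (m l p : d) :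
    Torus.partialDeriv m (fun y => n y l * n y p) =
      fun y => n y l * Torus.partialDeriv m n y p + Torus.partialDeriv m n y l * n y p := by
  funext y
  rw [partialDeriv_mul (c1_comp hn l) (c1_comp hn p),
    partialDeriv_apply_coord (hn.isContDiff (by simp)), partialDeriv_apply_coord (hn.isContDiff (by simp))]

/-- **Product rule for second partials of `n_l n_p`:**
`∂ₖ∂ₘ(n_l n_p) = (∂ₖ∂ₘn_l) n_p + n_l (∂ₖ∂ₘn_p) + ∂ₘn_l ∂ₖn_p + ∂ₖn_l ∂ₘn_p`. [folklore] -/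
theorem dd_axis_product (k m l p : d) (x : UnitAddTorus d) :
    dd k m (fun y => n y l * n y p) x =
      Torus.partialDeriv k (Torus.partialDeriv m n) x l * n x p
        + n x l * Torus.partialDeriv k (Torus.partialDeriv m n) x p
        + Torus.partialDeriv m n x l * Torus.partialDeriv k n x p
        + Torus.partialDeriv k n x l * Torus.partialDeriv m n x p := by
  unfold dd
  rw [partialDeriv_axis_product hn]
  have h13 : Torus.IsContDiff 1 (fun y => n y l * Torus.partialDeriv m n y p) :=
    ContDiff.mul (c1_comp hn l) (c1_dcomp hn m p)
  have h24 : Torus.IsContDiff 1 (fun y => Torus.partialDeriv m n y l * n y p) :=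
    ContDiff.mul (c1_dcomp hn m l) (c1_comp hn p)
  rw [show (fun y => n y l * Torus.partialDeriv m n y p + Torus.partialDeriv m n y l * n y p) =
      (fun y => n y l * Torus.partialDeriv m n y p) + fun y => Torus.partialDeriv m n y l * n y p from rfl,
    partialDeriv_add h13 h24, Pi.add_apply,
    partialDeriv_mul (c1_comp hn l) (c1_dcomp hn m p), partialDeriv_mul (c1_dcomp hn m l) (c1_comp hn p),
    partialDeriv_apply_coord (hn.isContDiff (by simp)), partialDeriv_apply_coord (hn.isContDiff (by simp)),
    partialDeriv_apply_coord ((hn.partialDeriv m).isContDiff (by simp)),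
    partialDeriv_apply_coord ((hn.partialDeriv m).isContDiff (by simp))]
  ring

/-- Mixed second partials of the axis commute (componentwise). [folklore] -/
theorem axis_hess_symm (k m l : d) (x : UnitAddTorus d) :
    Torus.partialDeriv k (Torus.partialDeriv m n) x l = Torus.partialDeriv m (Torus.partialDeriv k n) x l := by
  rw [partialDeriv_comm hn k m x]

variable (hn1 : ∀ x, ∑ i, n x i ^ 2 = 1)
include hn1

/-- **First unit constraint** `∑ᵢ nᵢ ∂ₖnᵢ = 0` (`∂ₖ|n|² = 0`). [folklore] -/
theorem unit_first (k : d) (x : UnitAddTorus d) : ∑ i, n x i * Torus.partialDeriv k n x i = 0 := by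
  have hconst : (fun y => ∑ i, n y i * n y i) = fun _ => (1 : ℝ) := by
    funext y; rw [← hn1 y]; exact Finset.sum_congr rfl fun i _ => by ring
  have h0 : Torus.partialDeriv k (fun y => ∑ i, n y i * n y i) x = 0 := by
    rw [hconst]; simp [Torus.partialDeriv, Torus.lineDeriv]
  have hs : ∀ i, Torus.IsContDiff 1 (fun y => n y i * n y i) :=
    fun i => ContDiff.mul (c1_comp hn i) (c1_comp hn i)
  rw [partialDeriv_finset_sum _ (fun i _ => hs i)] at h0
  simp only [partialDeriv_axis_product hn] at h0
  have : ∑ i, (n x i * Torus.partialDeriv k n x i + Torus.partialDeriv k n x i * n x i) =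
      2 * ∑ i, n x i * Torus.partialDeriv k n x i := by
    rw [Finset.mul_sum]; exact Finset.sum_congr rfl fun i _ => by ring
  rw [this] at h0
  linarith

/-- **Second unit constraint** `∑ᵢ nᵢ ∂ₖ∂ₘnᵢ = −∑ᵢ ∂ₖnᵢ ∂ₘnᵢ`. [folklore] -/
theorem unit_second (k m : d) (x : UnitAddTorus d) :
    ∑ i, n x i * Torus.partialDeriv k (Torus.partialDeriv m n) x i =
      -∑ i, Torus.partialDeriv k n x i * Torus.partialDeriv m n x i := by
  have hconst : (fun y => ∑ i, n y i * Torus.partialDeriv m n y i) = fun _ => (0 : ℝ) :=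
    funext fun y => unit_first hn hn1 m y
  have h0 : Torus.partialDeriv k (fun y => ∑ i, n y i * Torus.partialDeriv m n y i) x = 0 := by
    rw [hconst]; simp [Torus.partialDeriv, Torus.lineDeriv]
  have hs : ∀ i, Torus.IsContDiff 1 (fun y => n y i * Torus.partialDeriv m n y i) :=
    fun i => ContDiff.mul (c1_comp hn i) (c1_dcomp hn m i)
  rw [partialDeriv_finset_sum _ (fun i _ => hs i)] at h0
  have hterm : ∀ i, Torus.partialDeriv k (fun y => n y i * Torus.partialDeriv m n y i) x =
      n x i * Torus.partialDeriv k (Torus.partialDeriv m n) x i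
        + Torus.partialDeriv k n x i * Torus.partialDeriv m n x i := by
    intro i
    rw [partialDeriv_mul (c1_comp hn i) (c1_dcomp hn m i),
      partialDeriv_apply_coord (hn.isContDiff (by simp)),
      partialDeriv_apply_coord ((hn.partialDeriv m).isContDiff (by simp))]
  simp only [hterm, Finset.sum_add_distrib] at h0
  linarith

/-- The trace of `n⊗n` is the constant `1`, so all its second partials vanish:
`∑_l ∂ₐ∂_b(n_l n_l) = 0`. [folklore] -/
theorem dd_axis_trace (a b : d) (x : UnitAddTorus d) : ∑ l, dd a b (fun y => n y l * n y l) x = 0 := by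
  simp only [dd_axis_product hn]
  have h2 := unit_second hn hn1 a b x
  have e : ∑ l, (Torus.partialDeriv a (Torus.partialDeriv b n) x l * n x l
      + n x l * Torus.partialDeriv a (Torus.partialDeriv b n) x l
      + Torus.partialDeriv b n x l * Torus.partialDeriv a n x l
      + Torus.partialDeriv a n x l * Torus.partialDeriv b n x l) =
      2 * ∑ l, n x l * Torus.partialDeriv a (Torus.partialDeriv b n) x l
        + 2 * ∑ l, Torus.partialDeriv a n x l * Torus.partialDeriv b n x l := by
    rw [Finset.mul_sum, Finset.mul_sum, ← Finset.sum_add_distrib]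
    exact Finset.sum_congr rfl fun l _ => by ring
  rw [e, h2]
  ring

/-! ## 2. The three contractions -/

/-- Term `T1 = ∑ᵢⱼₖ nᵢnⱼ ∂ᵢ∂ₖ(nⱼnₖ) = −|a|² + Y`, `Y = ∑ᵢₖ nᵢ ∂ᵢ∂ₖnₖ`. [ours; calculus] -/
theorem axis_T1 (x : UnitAddTorus d) :
    ∑ i, ∑ j, n x i * n x j * ∑ k, dd i k (fun y => n y j * n y k) x =
      -(∑ l, (∑ k, Torus.partialDeriv k n x l * n x k) ^ 2)
        + ∑ i, ∑ k, n x i * Torus.partialDeriv i (Torus.partialDeriv k n) x k := by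
  -- expand into four triple sums
  have hexp : ∑ i, ∑ j, n x i * n x j * ∑ k, dd i k (fun y => n y j * n y k) x =
      (∑ i, ∑ j, ∑ k, n x i * n x j * (Torus.partialDeriv i (Torus.partialDeriv k n) x j * n x k))
      + (∑ i, ∑ j, ∑ k, n x i * n x j * (n x j * Torus.partialDeriv i (Torus.partialDeriv k n) x k))
      + (∑ i, ∑ j, ∑ k, n x i * n x j * (Torus.partialDeriv k n x j * Torus.partialDeriv i n x k))
      + (∑ i, ∑ j, ∑ k, n x i * n x j * (Torus.partialDeriv i n x j * Torus.partialDeriv k n x k)) := by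
    simp only [← Finset.sum_add_distrib, Finset.mul_sum]
    refine Finset.sum_congr rfl fun i _ => Finset.sum_congr rfl fun j _ =>
      Finset.sum_congr rfl fun k _ => ?_
    rw [dd_axis_product hn]; ring
  -- S1 = ∑ᵢₖ nᵢnₖ (∑ⱼ nⱼ h_{ikj}) = −∑ᵢₖ nᵢnₖ ∑ⱼ bⱼᵢbⱼₖ = −|a|²
  have S1 : ∑ i, ∑ j, ∑ k, n x i * n x j * (Torus.partialDeriv i (Torus.partialDeriv k n) x j * n x k) =
      -(∑ l, (∑ k, Torus.partialDeriv k n x l * n x k) ^ 2) := by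
    have step : ∑ i, ∑ j, ∑ k, n x i * n x j * (Torus.partialDeriv i (Torus.partialDeriv k n) x j * n x k) =
        ∑ i, ∑ k, (n x i * n x k) * ∑ j, n x j * Torus.partialDeriv i (Torus.partialDeriv k n) x j := by
      refine Finset.sum_congr rfl fun i _ => ?_
      rw [Finset.sum_comm]
      refine Finset.sum_congr rfl fun k _ => ?_
      rw [Finset.mul_sum]
      exact Finset.sum_congr rfl fun j _ => by ring
    have sq_exp : ∀ l, (∑ k, Torus.partialDeriv k n x l * n x k) ^ 2 =
        ∑ i, ∑ k, (Torus.partialDeriv i n x l * n x i) * (Torus.partialDeriv k n x l * n x k) := fun l => by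
      rw [sq, Finset.sum_mul_sum]
    rw [step]
    simp only [unit_second hn hn1, sq_exp]
    have lhs : ∑ i, ∑ k, n x i * n x k * -∑ j, Torus.partialDeriv i n x j * Torus.partialDeriv k n x j =
        -∑ i, ∑ k, ∑ j, n x i * n x k * (Torus.partialDeriv i n x j * Torus.partialDeriv k n x j) := by
      rw [← Finset.sum_neg_distrib]
      refine Finset.sum_congr rfl fun i _ => ?_
      rw [← Finset.sum_neg_distrib]
      refine Finset.sum_congr rfl fun k _ => ?_
      rw [mul_neg, Finset.mul_sum]
    have rhs : ∑ l, ∑ i, ∑ k, (Torus.partialDeriv i n x l * n x i) * (Torus.partialDeriv k n x l * n x k) =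
        ∑ i, ∑ k, ∑ j, n x i * n x k * (Torus.partialDeriv i n x j * Torus.partialDeriv k n x j) := by
      rw [Finset.sum_comm]
      refine Finset.sum_congr rfl fun i _ => ?_
      rw [Finset.sum_comm]
      exact Finset.sum_congr rfl fun k _ => Finset.sum_congr rfl fun l _ => by ring
    rw [lhs, rhs]
  -- S2 = (∑ⱼ nⱼ²) Y = Y
  have S2 : ∑ i, ∑ j, ∑ k, n x i * n x j * (n x j * Torus.partialDeriv i (Torus.partialDeriv k n) x k) =
      ∑ i, ∑ k, n x i * Torus.partialDeriv i (Torus.partialDeriv k n) x k := by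
    have step : ∑ i, ∑ j, ∑ k, n x i * n x j * (n x j * Torus.partialDeriv i (Torus.partialDeriv k n) x k) =
        ∑ i, ∑ k, (n x i * Torus.partialDeriv i (Torus.partialDeriv k n) x k) * ∑ j, n x j ^ 2 := by
      refine Finset.sum_congr rfl fun i _ => ?_
      rw [Finset.sum_comm]
      refine Finset.sum_congr rfl fun k _ => ?_
      rw [Finset.mul_sum]
      exact Finset.sum_congr rfl fun j _ => by ring
    rw [step]
    simp only [hn1, mul_one]
  -- S3 = ∑ᵢₖ nᵢ bₖᵢ (∑ⱼ nⱼ bⱼₖ) = 0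
  have S3 : ∑ i, ∑ j, ∑ k, n x i * n x j * (Torus.partialDeriv k n x j * Torus.partialDeriv i n x k) = 0 := by
    have step : ∑ i, ∑ j, ∑ k, n x i * n x j * (Torus.partialDeriv k n x j * Torus.partialDeriv i n x k) =
        ∑ i, ∑ k, (n x i * Torus.partialDeriv i n x k) * ∑ j, n x j * Torus.partialDeriv k n x j := by
      refine Finset.sum_congr rfl fun i _ => ?_
      rw [Finset.sum_comm]
      refine Finset.sum_congr rfl fun k _ => ?_
      rw [Finset.mul_sum]
      exact Finset.sum_congr rfl fun j _ => by ring
    rw [step]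
    simp only [unit_first hn hn1, mul_zero, Finset.sum_const_zero]
  -- S4 = θ ∑ᵢ nᵢ (∑ⱼ nⱼ bⱼᵢ) = 0
  have S4 : ∑ i, ∑ j, ∑ k, n x i * n x j * (Torus.partialDeriv i n x j * Torus.partialDeriv k n x k) = 0 := by
    have step : ∑ i, ∑ j, ∑ k, n x i * n x j * (Torus.partialDeriv i n x j * Torus.partialDeriv k n x k) =
        ∑ i, (n x i * ∑ k, Torus.partialDeriv k n x k) * ∑ j, n x j * Torus.partialDeriv i n x j := by
      refine Finset.sum_congr rfl fun i _ => ?_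
      rw [Finset.mul_sum]
      refine Finset.sum_congr rfl fun j _ => ?_
      rw [Finset.mul_sum, Finset.sum_mul]
      exact Finset.sum_congr rfl fun k _ => by ring
    rw [step]
    simp only [unit_first hn hn1, mul_zero, Finset.sum_const_zero]
  rw [hexp, S1, S2, S3, S4]
  ring

/-- Term `T2 = ∑ᵢⱼₖ nᵢnⱼ ∂ₖ∂ₖ(nᵢnⱼ) = −2|∇n|²`. [ours; calculus] -/
theorem axis_T2 (x : UnitAddTorus d) :
    ∑ i, ∑ j, n x i * n x j * ∑ k, dd k k (fun y => n y i * n y j) x =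
      -2 * ∑ l, ∑ k, Torus.partialDeriv k n x l ^ 2 := by
  have hexp : ∑ i, ∑ j, n x i * n x j * ∑ k, dd k k (fun y => n y i * n y j) x =
      (∑ i, ∑ j, ∑ k, n x i * n x j * (Torus.partialDeriv k (Torus.partialDeriv k n) x i * n x j))
      + (∑ i, ∑ j, ∑ k, n x i * n x j * (n x i * Torus.partialDeriv k (Torus.partialDeriv k n) x j))
      + (∑ i, ∑ j, ∑ k, n x i * n x j * (Torus.partialDeriv k n x i * Torus.partialDeriv k n x j))
      + (∑ i, ∑ j, ∑ k, n x i * n x j * (Torus.partialDeriv k n x i * Torus.partialDeriv k n x j)) := by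
    simp only [← Finset.sum_add_distrib, Finset.mul_sum]
    refine Finset.sum_congr rfl fun i _ => Finset.sum_congr rfl fun j _ =>
      Finset.sum_congr rfl fun k _ => ?_
    rw [dd_axis_product hn]; ring
  have U1 : ∑ i, ∑ j, ∑ k, n x i * n x j * (Torus.partialDeriv k (Torus.partialDeriv k n) x i * n x j) =
      -∑ k, ∑ i, Torus.partialDeriv k n x i * Torus.partialDeriv k n x i := by
    have step : ∑ i, ∑ j, ∑ k, n x i * n x j * (Torus.partialDeriv k (Torus.partialDeriv k n) x i * n x j) =
        ∑ i, ∑ k, (n x i * Torus.partialDeriv k (Torus.partialDeriv k n) x i) * ∑ j, n x j ^ 2 := by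
      refine Finset.sum_congr rfl fun i _ => ?_
      rw [Finset.sum_comm]
      refine Finset.sum_congr rfl fun k _ => ?_
      rw [Finset.mul_sum]
      exact Finset.sum_congr rfl fun j _ => by ring
    rw [step]
    simp only [hn1, mul_one]
    rw [Finset.sum_comm]
    simp only [unit_second hn hn1, Finset.sum_neg_distrib]
  have U2 : ∑ i, ∑ j, ∑ k, n x i * n x j * (n x i * Torus.partialDeriv k (Torus.partialDeriv k n) x j) =
      -∑ k, ∑ j, Torus.partialDeriv k n x j * Torus.partialDeriv k n x j := by
    have step : ∑ i, ∑ j, ∑ k, n x i * n x j * (n x i * Torus.partialDeriv k (Torus.partialDeriv k n) x j) =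
        ∑ j, ∑ k, (n x j * Torus.partialDeriv k (Torus.partialDeriv k n) x j) * ∑ i, n x i ^ 2 := by
      rw [Finset.sum_comm]
      refine Finset.sum_congr rfl fun j _ => ?_
      rw [Finset.sum_comm]
      refine Finset.sum_congr rfl fun k _ => ?_
      rw [Finset.mul_sum]
      exact Finset.sum_congr rfl fun i _ => by ring
    rw [step]
    simp only [hn1, mul_one]
    rw [Finset.sum_comm]
    simp only [unit_second hn hn1, Finset.sum_neg_distrib]
  have U3 : ∑ i, ∑ j, ∑ k, n x i * n x j * (Torus.partialDeriv k n x i * Torus.partialDeriv k n x j) = 0 := by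
    have step : ∑ i, ∑ j, ∑ k, n x i * n x j * (Torus.partialDeriv k n x i * Torus.partialDeriv k n x j) =
        ∑ i, ∑ k, (n x i * Torus.partialDeriv k n x i) * ∑ j, n x j * Torus.partialDeriv k n x j := by
      refine Finset.sum_congr rfl fun i _ => ?_
      rw [Finset.sum_comm]
      refine Finset.sum_congr rfl fun k _ => ?_
      rw [Finset.mul_sum]
      exact Finset.sum_congr rfl fun j _ => by ring
    rw [step]
    simp only [unit_first hn hn1, mul_zero, Finset.sum_const_zero]
  rw [hexp, U1, U2, U3]
  have hsq : ∑ l, ∑ k, Torus.partialDeriv k n x l ^ 2 =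
      ∑ k, ∑ i, Torus.partialDeriv k n x i * Torus.partialDeriv k n x i := by
    rw [Finset.sum_comm]
    exact Finset.sum_congr rfl fun k _ => Finset.sum_congr rfl fun i _ => by ring
  rw [hsq]
  ring

omit hn1 in
/-- Term `T3 = ∑ₖₗ ∂ₖ∂ₗ(nₖnₗ) = 2Y + θ² + tr((∇n)²)`. [ours; calculus] -/
theorem axis_T3 (x : UnitAddTorus d) :
    ∑ k, ∑ l, dd k l (fun y => n y k * n y l) x =
      2 * (∑ i, ∑ k, n x i * Torus.partialDeriv i (Torus.partialDeriv k n) x k)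
        + (∑ k, Torus.partialDeriv k n x k) ^ 2
        + ∑ l, ∑ k, Torus.partialDeriv k n x l * Torus.partialDeriv l n x k := by
  have hexp : ∑ k, ∑ l, dd k l (fun y => n y k * n y l) x =
      (∑ k, ∑ l, Torus.partialDeriv k (Torus.partialDeriv l n) x k * n x l)
      + (∑ k, ∑ l, n x k * Torus.partialDeriv k (Torus.partialDeriv l n) x l)
      + (∑ k, ∑ l, Torus.partialDeriv l n x k * Torus.partialDeriv k n x l)
      + (∑ k, ∑ l, Torus.partialDeriv k n x k * Torus.partialDeriv l n x l) := by
    simp only [← Finset.sum_add_distrib]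
    exact Finset.sum_congr rfl fun k _ => Finset.sum_congr rfl fun l _ => by rw [dd_axis_product hn]
  have V1 : ∑ k, ∑ l, Torus.partialDeriv k (Torus.partialDeriv l n) x k * n x l =
      ∑ i, ∑ k, n x i * Torus.partialDeriv i (Torus.partialDeriv k n) x k := by
    rw [Finset.sum_comm]
    exact Finset.sum_congr rfl fun l _ => Finset.sum_congr rfl fun k _ => by
      rw [axis_hess_symm hn k l k x]; ring
  have V3 : ∑ k, ∑ l, Torus.partialDeriv l n x k * Torus.partialDeriv k n x l =
      ∑ l, ∑ k, Torus.partialDeriv k n x l * Torus.partialDeriv l n x k :=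
    Finset.sum_congr rfl fun k _ => Finset.sum_congr rfl fun l _ => by ring
  have V4 : ∑ k, ∑ l, Torus.partialDeriv k n x k * Torus.partialDeriv l n x l =
      (∑ k, Torus.partialDeriv k n x k) ^ 2 := by
    rw [sq, Finset.sum_mul_sum]
  rw [hexp, V1, V3, V4]
  ring

/-! ## 3. The geometric identity -/

omit [Fintype d] [DecidableEq d] hn hn1 in
/-- The entry functions of `y ↦ n(y)⊗n(y)`. [folklore; bookkeeping] -/
theorem entryFun_axis (i j : d) :
    entryFun (fun y => Matrix.vecMulVec (n y) (n y)) i j = fun y => n y i * n y j := by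
  funext y; simp [entryFun, Matrix.vecMulVec_apply]

/-- **THE GEOMETRIC IDENTITY (SIEVELD §3.4b (4e)(i), ε-free, every dimension).** For a smooth unit field
`n` and every point `x`:
`J(n⊗n; n(x))(x) = 2(|∇n|² − |(n·∇)n|²) − tr((∇n)²) − (div n)²` — every second derivative of `n` cancels.
[ours; in `d = 3` this is `nᵀ inc(n⊗n) n = −2[σ₂(∇n) − (n·curl n)²]`] -/
theorem svForm_axis (x : UnitAddTorus d) :
    svForm (fun y => Matrix.vecMulVec (n y) (n y)) (fun i => n x i) x =
      2 * (∑ l, ∑ k, Torus.partialDeriv k n x l ^ 2 - ∑ l, (∑ k, Torus.partialDeriv k n x l * n x k) ^ 2)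
        - ∑ l, ∑ k, Torus.partialDeriv k n x l * Torus.partialDeriv l n x k
        - (∑ k, Torus.partialDeriv k n x k) ^ 2 := by
  unfold svForm
  simp only [entryFun_axis]
  have hbr : ∀ i j, (2 * ∑ k, dd i k (fun y => n y j * n y k) x - ∑ k, dd k k (fun y => n y i * n y j) x
      - ∑ l, dd i j (fun y => n y l * n y l) x) =
      2 * ∑ k, dd i k (fun y => n y j * n y k) x - ∑ k, dd k k (fun y => n y i * n y j) x := by
    intro i j; rw [dd_axis_trace hn hn1]; ring
  simp only [hbr]
  have htrk : ∑ k, ∑ l, dd k k (fun y => n y l * n y l) x = 0 :=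
    Finset.sum_eq_zero fun k _ => dd_axis_trace hn hn1 k k x
  rw [htrk, zero_sub, axis_T3 hn]
  have hsplit : ∑ i, ∑ j, n x i * n x j *
      (2 * ∑ k, dd i k (fun y => n y j * n y k) x - ∑ k, dd k k (fun y => n y i * n y j) x) =
      2 * (∑ i, ∑ j, n x i * n x j * ∑ k, dd i k (fun y => n y j * n y k) x)
        - ∑ i, ∑ j, n x i * n x j * ∑ k, dd k k (fun y => n y i * n y j) x := by
    rw [Finset.mul_sum, ← Finset.sum_sub_distrib]
    refine Finset.sum_congr rfl fun i _ => ?_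
    rw [Finset.mul_sum, ← Finset.sum_sub_distrib]
    exact Finset.sum_congr rfl fun j _ => by ring
  rw [hsplit, axis_T1 hn hn1, axis_T2 hn hn1]
  have h1 : (∑ i, n x i ^ 2) = 1 := hn1 x
  rw [h1]
  ring

end Axis

end BiaxialEikonal

end Summit.NavierStokesRegularity.FunctionalMining

end
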